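import Literature.MathematicalPhysics.QuantumFieldTheory.QCDFlavourSymmetry
import Literature.MathematicalPhysics.QuantumFieldTheory.QCDTorusTranslation
import Summits.QuantumFields.QCD.Theorems.QuarksNoInfraredClauseTorusHalfSpectrumStubSupercommute
import HarnessLib

/-!
# Crux `TorusHalfSpectrum` (stmt-QuantumFields-9508), line `registered` (`Lines/birth.lean`, reshape v5) —
# stub `stub_fourPoint_regrouping`: the torus four-point regrouping identity (Haag's splitting identity)

Stub E1 of the birth skeleton of the crux
`Summit.QuantumFields.QCD.Theses.QuarksNoInfraredClause.TorusHalfSpectrum` (= `FourPointRegroupStmt`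
unfolded).  On the odd torus of side `2S+1`, for gauge-invariant local lattice-QCD observables `A, B, A', B'`
with `B` and `A'` HOMOGENEOUS of flavour charges `q_B, q_{A'} ∈ ℤ^{N_f}` under the vector flavour torus, and
for composites given by their placement identities

* `M = A · τ_v B`, `M' = A' · τ_v B'` (the "time split": `M(u) = A(u) B(u+v)`, `M'(u) = A'(u) B'(u+v)`),
* `N = A · τ_w A'`, `N' = B · τ_w B'` (the "space split": `N(u) = A(u) A'(u+w)`, `N'(u) = B(u) B'(u+w)`),

the Euclidean four-point function `⟨A(0) B(v) A'(w) B'(w+v)⟩` regroups: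

1. `⟨M(0) M'(w)⟩ = (−1)^{|∑_f q_{B,f}| |∑_f q_{A',f}|} ⟨N(0) N'(v)⟩`;
2. `⟨M'(w)⟩ = ⟨A'(0) B'(v)⟩`;
3. `⟨N'(v)⟩ = ⟨B(0) B'(w)⟩`.

This is the Euclidean (lattice, finite-torus) form of the splitting step of the half-spectrum lemma
(Haag 1996, Thm II.5.4.1), written on the statement's own tori.

Proof.  (1) Pointwise in the gauge background `U`:
`M(0) M'(w) = A(0) B(v) · A'(w) B'(w+v)` by the placement identities; reassociate, swap the middle pair with
the graded commutation rule of torus placements of flavour-homogeneous observables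
(`Supercommute.stub_homogeneous_supercommute`, stub G: `B(v) A'(w) = (−1)^{|q_B||q_{A'}|} A'(w) B(v)`), move the
sign out of the product and regroup to `A(0) A'(w) · B(v) B'(v+w) = N(0) N'(v)`; then `qcdTorusExpect_smul`
pulls the sign out of the expectation.  (2), (3) The placement identities at `u = w`, resp. `u = v`, and
translation invariance of two-point functions of the honest functional
(`qcdTorusExpect_onTorus_mul_onTorus_add`, translation by `w`, resp. `v`).

Everything used is proved in the tree (no named fact).  Sources: R. Haag, *Local Quantum Physics* (2nd ed.,
Springer 1996), Thm II.5.4.1 (the half-spectrum / splitting argument); K. Osterwalder, E. Seiler, Ann. Phys.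
110 (1978) 440, §2 (translation invariance of the lattice functional, the algebra of gauge-invariant local
observables); F. A. Berezin, *The Method of Second Quantization* (1966), Ch. I §3 (Grassmann parity and signs).
-/

noncomputable section

namespace Summit.QuantumFields.QCD.Cruxes.TorusHalfSpectrum.Birth.FourPointRegroup

open scoped BigOperators
open Literature.MathematicalPhysics.QuantumFieldTheory

/-! ### The stub -/

/-- **Stub E1: the torus four-point regrouping identity** (Haag's splitting identity on the odd tori).  For
placements `A(0) B(v) A'(w) B'(w+v)` with `B`, `A'` flavour-homogeneous of charges `q_B`, `q_{A'}`, and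
composites `M = A·τ_v B`, `M' = A'·τ_v B'`, `N = A·τ_w A'`, `N' = B·τ_w B'` given by their placement
identities, on every odd torus `⟨M(0) M'(w)⟩ = (−1)^{|∑ q_B| |∑ q_{A'}|} ⟨N(0) N'(v)⟩`,
`⟨M'(w)⟩ = ⟨A'(0) B'(v)⟩` and `⟨N'(v)⟩ = ⟨B(0) B'(w)⟩`. -/
theorem stub_fourPoint_regrouping :
    ∀ (Nf RA RB RA' RB' RM RM' RN RN' : ℕ) (A : QCDLatticeObservable Nf RA) (B : QCDLatticeObservable Nf RB)
      (A' : QCDLatticeObservable Nf RA') (B' : QCDLatticeObservable Nf RB')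
      (M : QCDLatticeObservable Nf RM) (M' : QCDLatticeObservable Nf RM')
      (N : QCDLatticeObservable Nf RN) (N' : QCDLatticeObservable Nf RN')
      (qB qA' : Fin Nf → ℤ) (v w : _root_.Literature.Probability.LatticeModels.Site 4),
      (∀ t : Fin Nf → ℂ, (∀ f, t f ≠ 0) → ∀ U,
          QCDLatticeObservable.flavourScale t (B.F U) = (∏ f, t f ^ (qB f)) • B.F U) →
      (∀ t : Fin Nf → ℂ, (∀ f, t f ≠ 0) → ∀ U,
          QCDLatticeObservable.flavourScale t (A'.F U) = (∏ f, t f ^ (qA' f)) • A'.F U) →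
      (∀ (S : ℕ) (u : _root_.Literature.Probability.LatticeModels.Site 4)
          (U : GaugeConfig 4 (2 * S + 1) (Matrix.specialUnitaryGroup (Fin 3) ℂ)),
          M.onTorus (2 * S + 1) u U = A.onTorus (2 * S + 1) u U * B.onTorus (2 * S + 1) (u + v) U) →
      (∀ (S : ℕ) (u : _root_.Literature.Probability.LatticeModels.Site 4)
          (U : GaugeConfig 4 (2 * S + 1) (Matrix.specialUnitaryGroup (Fin 3) ℂ)),
          M'.onTorus (2 * S + 1) u U = A'.onTorus (2 * S + 1) u U * B'.onTorus (2 * S + 1) (u + v) U) →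
      (∀ (S : ℕ) (u : _root_.Literature.Probability.LatticeModels.Site 4)
          (U : GaugeConfig 4 (2 * S + 1) (Matrix.specialUnitaryGroup (Fin 3) ℂ)),
          N.onTorus (2 * S + 1) u U = A.onTorus (2 * S + 1) u U * A'.onTorus (2 * S + 1) (u + w) U) →
      (∀ (S : ℕ) (u : _root_.Literature.Probability.LatticeModels.Site 4)
          (U : GaugeConfig 4 (2 * S + 1) (Matrix.specialUnitaryGroup (Fin 3) ℂ)),
          N'.onTorus (2 * S + 1) u U = B.onTorus (2 * S + 1) u U * B'.onTorus (2 * S + 1) (u + w) U) →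
      ∀ (β : ℝ) (S : ℕ) (mq : Fin Nf → ℝ),
        qcdTorusExpect β (2 * S + 1) mq
              (fun U => M.onTorus (2 * S + 1) 0 U * M'.onTorus (2 * S + 1) w U) =
            (-1 : ℂ) ^ ((∑ f, qB f) * (∑ f, qA' f)).natAbs *
              qcdTorusExpect β (2 * S + 1) mq
                (fun U => N.onTorus (2 * S + 1) 0 U * N'.onTorus (2 * S + 1) v U) ∧
          qcdTorusExpect β (2 * S + 1) mq (M'.onTorus (2 * S + 1) w) =
            qcdTorusExpect β (2 * S + 1) mq
              (fun U => A'.onTorus (2 * S + 1) 0 U * B'.onTorus (2 * S + 1) v U) ∧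
          qcdTorusExpect β (2 * S + 1) mq (N'.onTorus (2 * S + 1) v) =
            qcdTorusExpect β (2 * S + 1) mq
              (fun U => B.onTorus (2 * S + 1) 0 U * B'.onTorus (2 * S + 1) w U) := by
  intro Nf RA RB RA' RB' RM RM' RN RN' A B A' B' M M' N N' qB qA' v w hB hA' hM hM' hN hN' β S mq
  refine ⟨?_, ?_, ?_⟩
  · -- (1) pointwise regrouping `M(0) M'(w) = (−1)^{|q_B||q_{A'}|} • N(0) N'(v)`, then pull the sign out.
    have hpt : (fun U => M.onTorus (2 * S + 1) 0 U * M'.onTorus (2 * S + 1) w U) =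
        fun U => ((-1 : ℂ) ^ ((∑ f, qB f) * (∑ f, qA' f)).natAbs) •
          (N.onTorus (2 * S + 1) 0 U * N'.onTorus (2 * S + 1) v U) := by
      funext U
      rw [hM S 0 U, hM' S w U, hN S 0 U, hN' S v U, zero_add, zero_add, add_comm w v, mul_assoc,
        ← mul_assoc (B.onTorus (2 * S + 1) v U),
        Supercommute.stub_homogeneous_supercommute Nf RB RA' B A' qB qA' hB hA' (2 * S + 1) v w U,
        smul_mul_assoc, mul_smul_comm, mul_assoc, mul_assoc]
    rw [hpt, qcdTorusExpect_smul]
  · -- (2) `⟨M'(w)⟩ = ⟨A'(w) B'(w+v)⟩ = ⟨A'(0) B'(v)⟩` (translation by `w`).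
    have h := qcdTorusExpect_onTorus_mul_onTorus_add (S := 2 * S + 1) β mq A' B' 0 v w
    rw [zero_add, add_comm v w] at h
    rw [show M'.onTorus (2 * S + 1) w =
        fun U => A'.onTorus (2 * S + 1) w U * B'.onTorus (2 * S + 1) (w + v) U
      from funext fun U => hM' S w U]
    exact h
  · -- (3) `⟨N'(v)⟩ = ⟨B(v) B'(v+w)⟩ = ⟨B(0) B'(w)⟩` (translation by `v`).
    have h := qcdTorusExpect_onTorus_mul_onTorus_add (S := 2 * S + 1) β mq B B' 0 w v
    rw [zero_add, add_comm w v] at h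
    rw [show N'.onTorus (2 * S + 1) v =
        fun U => B.onTorus (2 * S + 1) v U * B'.onTorus (2 * S + 1) (v + w) U
      from funext fun U => hN' S v U]
    exact h

end Summit.QuantumFields.QCD.Cruxes.TorusHalfSpectrum.Birth.FourPointRegroup

end
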